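import Mathlib
import Summits.NavierStokesRegularity.NavierStokesRegularity.Theorems.QuarterLogPincerHelmholtzCentreDefs
import Summits.NavierStokesRegularity.NavierStokesRegularity.Theorems.TypeIQuantSubcubicExp.Negative.ShellKernelLoadBearing
import HarnessLib

/-!
# H2 / H2♭ of `vortical_centre` BY NAME: `div v = 0` is load-bearing for both — refuter lane ns-afl-r1

Supports crux stmt-NavierStokesRegularity-24077 (`QuarterLogPincer.TypeIQuantSubcubicExp`) via ns-idea-7's line
`vortical_centre` v1.2, whose statements H2 `HarmonicRemainder` and H2♭ `ShellKernelBound` are now in the tree BY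
NAME (typer port `…Theorems.QuarterLogPincerHelmholtzCentreDefs`, with `cutVorticity v y R = χ_{y,R/3}·curl v`).

* `shellKernelBound_false_without_divFree'` — H2♭ with `VectorCalculus.IsDivFree v` deleted, stated with the
  port's `cutVorticity`: FALSE (definitionally the landed `shellKernelBound_false_without_divFree`, p713230).
* `harmonicRemainder_false_without_divFree` — H2 with `IsDivFree v` deleted: FALSE, by the same compactly supported
  gradient field `v = ∇(⟨e₀,x⟩·ballCutoff 0 1 x)` (`curl v = 0`, `v(0) = e₀`): with `E = ‖v‖²_{L²(ℝ³)}`, `W = 0` the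
  bound reads `1 ≤ C√(E/R³)`, false at `R = C²E + 1`.

Reading: in both centre estimates the divergence constraint is what ties `v(y)` to its vorticity; for gradient
fields the Biot–Savart term and the enstrophy vanish while `v(y)` does not.  (H1 `HelmholtzNearField` has no
`IsDivFree` hypothesis and is PROVED in the tree, `helmholtzNearField_holds`.)

HONEST FRAME: hypothesis bookkeeping on NS-free stubs below the crux; nothing here bears on 24077's truth, W7 or
Navier–Stokes regularity (OPEN).  Refuter/instrument seat ns-afl-r1 g12, `--supports stmt-NavierStokesRegularity-24077`,
Negative lane (no Theses statement is asserted).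
-/

set_option linter.dupNamespace false

noncomputable section

open MeasureTheory Set Metric InnerProductSpace
open scoped ENNReal
open Literature.Analysis Literature.Analysis.FluidPDE
open Summit.NavierStokesRegularity.NavierStokesRegularity.Cruxes.TypeIQuantSubcubicExp.HelmholtzCentre
  (cutVorticity cutVorticity_apply)

namespace Summit.NavierStokesRegularity.NavierStokesRegularity.Theorems.TypeIQuantSubcubicExp.Negative.HelmholtzCentre

/-- **H2♭ needs `div v = 0`** (by-name form, `cutVorticity` of the port). -/
theorem shellKernelBound_false_without_divFree' :
    ¬ ∃ C : ℝ, 1 ≤ C ∧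
      ∀ (v : (EuclideanSpace ℝ (Fin 3)) → (EuclideanSpace ℝ (Fin 3))), ContDiff ℝ 2 v →
        ∀ (y : EuclideanSpace ℝ (Fin 3)) (R : ℝ), 0 < R →
          ‖v y - biotSavart (cutVorticity v y R) y‖ ≤
            C * ((R ^ 3)⁻¹ * (∫ x in ball y R, ‖v x‖) + (R ^ 2)⁻¹ * (∫ x in ball y R, ‖curl v x‖)) :=
  shellKernelBound_false_without_divFree

/-- **H2 `HarmonicRemainder` needs `div v = 0`**: with the divergence-free hypothesis deleted the statement is
FALSE (gradient witness, `W = 0`, `E = ‖v‖²_{L²}`, `R = C²E + 1`). [folklore] -/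
theorem harmonicRemainder_false_without_divFree :
    ¬ ∃ C : ℝ, 1 ≤ C ∧
      ∀ (v : (EuclideanSpace ℝ (Fin 3)) → (EuclideanSpace ℝ (Fin 3))), ContDiff ℝ 2 v →
        ∀ (y : EuclideanSpace ℝ (Fin 3)) (R E W : ℝ), 0 < R →
          (∫⁻ x in ball y R, ENNReal.ofReal (‖v x‖ ^ 2) ≤ ENNReal.ofReal E) → 0 ≤ E →
          (∫⁻ x in ball y R, ‖curl v x‖ₑ ^ 2 ≤ ENNReal.ofReal W) → 0 ≤ W →
          ‖v y - biotSavart (cutVorticity v y R) y‖ ≤ C * (Real.sqrt (E / R ^ 3) + Real.sqrt (W / R)) := by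
  rintro ⟨C, hC, H⟩
  set v : EuclideanSpace ℝ (Fin 3) → EuclideanSpace ℝ (Fin 3) :=
    gradient (fun x : EuclideanSpace ℝ (Fin 3) =>
      (innerSL ℝ (EuclideanSpace.single (0 : Fin 3) (1 : ℝ))) x * ballCutoff 0 1 x) with hv
  have hv2 : ContDiff ℝ 2 v := contDiff_gradient_potential
  have hcurl : ∀ x, curl v x = 0 := curl_gradient_potential
  have hv0 : ‖v 0‖ = 1 := by
    rw [hv, gradient_potential_zero]; simp
  -- the slice energy `E = ∫ ‖v‖²` over `ℝ³`
  have hcs2 : HasCompactSupport (fun x => ‖v x‖ ^ 2) :=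
    hasCompactSupport_gradient_potential.comp_left (g := fun w : EuclideanSpace ℝ (Fin 3) => ‖w‖ ^ 2) (by simp)
  have hint2 : Integrable (fun x => ‖v x‖ ^ 2) :=
    ((hv2.continuous.norm).pow 2).integrable_of_hasCompactSupport hcs2
  set E : ℝ := ∫ x, ‖v x‖ ^ 2 with hE
  have hE0 : 0 ≤ E := integral_nonneg fun _ => by positivity
  have hC0 : 0 < C := by linarith
  -- the radius
  set R : ℝ := C ^ 2 * E + 1 with hR
  have hR1 : 1 ≤ R := by rw [hR]; nlinarith
  have hR0 : 0 < R := by linarith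
  have hL2 : ∫⁻ x in ball (0 : EuclideanSpace ℝ (Fin 3)) R, ENNReal.ofReal (‖v x‖ ^ 2) ≤ ENNReal.ofReal E := by
    calc ∫⁻ x in ball (0 : EuclideanSpace ℝ (Fin 3)) R, ENNReal.ofReal (‖v x‖ ^ 2)
        ≤ ∫⁻ x, ENNReal.ofReal (‖v x‖ ^ 2) := setLIntegral_le_lintegral _ _
      _ = ENNReal.ofReal E :=
          (ofReal_integral_eq_lintegral_ofReal hint2 (ae_of_all _ fun _ => by positivity)).symm
  have hW : ∫⁻ x in ball (0 : EuclideanSpace ℝ (Fin 3)) R, ‖curl v x‖ₑ ^ 2 ≤ ENNReal.ofReal 0 := by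
    simp [hcurl]
  have key := H v hv2 0 R E 0 hR0 hL2 hE0 hW le_rfl
  -- the Biot–Savart term and the `W`-term vanish
  have hcut : cutVorticity v 0 R = 0 := by
    funext x; simp [cutVorticity_apply, hcurl x]
  have hBS : biotSavart (cutVorticity v 0 R) 0 = 0 := by
    rw [hcut, biotSavart_zero]; rfl
  rw [hBS, sub_zero, hv0, zero_div, Real.sqrt_zero, add_zero] at key
  -- `C √(E/R³) < 1` at `R = C²E + 1`
  have hR3 : R ≤ R ^ 3 := by
    have h1 : 1 ≤ R ^ 2 := by nlinarith
    calc R = R * 1 := (mul_one R).symm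
      _ ≤ R * R ^ 2 := mul_le_mul_of_nonneg_left h1 hR0.le
      _ = R ^ 3 := by ring
  have hq : E / R ^ 3 < (1 / C) ^ 2 := by
    have h1 : E / R ^ 3 ≤ E / R := div_le_div_of_nonneg_left hE0 hR0 hR3
    have h2 : E / R < (1 / C) ^ 2 := by
      rw [div_lt_iff₀ hR0, hR]
      have : (1 / C) ^ 2 * (C ^ 2 * E + 1) = E + (1 / C) ^ 2 := by field_simp
      rw [this]
      have : 0 < (1 / C) ^ 2 := by positivity
      linarith
    exact lt_of_le_of_lt h1 h2
  have hs : Real.sqrt (E / R ^ 3) < 1 / C := (Real.sqrt_lt' (by positivity)).2 hq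
  have h3 : C * Real.sqrt (E / R ^ 3) < 1 := by
    have := mul_lt_mul_of_pos_left hs hC0
    rwa [mul_one_div_cancel hC0.ne'] at this
  linarith

end Summit.NavierStokesRegularity.NavierStokesRegularity.Theorems.TypeIQuantSubcubicExp.Negative.HelmholtzCentre

end
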